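import Literature.AlgebraicGeometry.Frobenioids.BirationalNormalizationExample
import Literature.AlgebraicGeometry.Frobenioids.ElementaryFrobeniusCompact
import Literature.AlgebraicGeometry.Frobenioids.IrreducibleMorphismsCounterexample
import Literature.AlgebraicGeometry.Frobenioids.MonoidTransport
import Mathlib.Algebra.Group.Equiv.TypeTags
import HarnessLib

/-!
# Frobenioids I, Example 4.6: the morphisms of `C` over `F_Φ` (pre-Frobenioid structure, classes of
# morphisms) — part 1 of the proof that `C` is a Frobenioid

Mochizuki, *The geometry of Frobenioids I: the general theory*, Kyushu J. Math. **62** (2008)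
293–400, kurims text pp. 86–87 [cite: MochizukiFrdI2008, Ex. 4.6 pp.86-87]. PROOF-ONLY companion of
`BirationalNormalizationExample.lean` (seat abc-iut-L1-t8: the datum `P : Ex46.Datum G`, the monoid `N` on
`M × N_{≥1}`, the category `C` with objects `A_n` and `Hom(A_{n₁}, A_{n₂}) = {(g, a, b, d) ∈ N : a, b ≥ 0,
n₂ − d n₁ = a + b}`, the functor `Ex46.toElem P : C → F_Φ` over the one-morphism category, `Φ ≡ ℤ_{≥0}²`),
towards "one checks immediately that, relative to this last functor, `C` is a Frobenioid" (p. 87).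

This part (no new definitions): the coordinates `(g, a, b, d)` of composites; `C → F_Φ` is a
pre-Frobenioid (`Ex46.isPreFrobenioid`: `Φ` divisorial, `C` connected and totally epimorphic); and the
dictionary of [FrdI] Def. 1.2 for `C`: isomorphisms `= (g, 0, 0, 1)` (`isIso_iff`), linear `⟺ d = 1`,
isometry `⟺ a = b = 0`, every morphism is a base-isomorphism / base-identity and **co-angular** (isometric
pre-steps are isomorphisms), pre-steps `⟺ d = 1` (and they are monomorphisms), Frobenius type `⟺ a = b = 0`,
pull-back morphisms `=` isomorphisms. Parts 2–3 (`…Clauses.lean`, `…IsFrobenioid.lean`) verify Def. 1.3.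
No statement of the paper is strengthened; nothing here takes a side on [IUTchIII] Cor. 3.12.
-/

namespace Literature.AlgebraicGeometry.Frobenioids

open CategoryTheory Opposite

namespace Ex46

open PreFrobenioid

variable {G : Type} [AddCommGroup G] (P : Datum G)

/-! ### Coordinates of morphisms -/

/-- `a ≥ 0`. [cite: MochizukiFrdI2008, Ex. 4.6 p.87] -/
theorem a_nonneg {A B : Obj P} (f : A ⟶ B) : 0 ≤ (val P f).a := f.2.1

/-- `b ≥ 0`. [cite: MochizukiFrdI2008, Ex. 4.6 p.87] -/
theorem b_nonneg {A B : Obj P} (f : A ⟶ B) : 0 ≤ (val P f).b := f.2.2.1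

/-- `n₂ − d · n₁ = a + b`. [cite: MochizukiFrdI2008, Ex. 4.6 p.87] -/
theorem idx_eq {A B : Obj P} (f : A ⟶ B) : B.idx - ((val P f).d : ℤ) * A.idx = (val P f).a + (val P f).b := f.2.2.2

/-- A morphism is determined by its element of `N`. [cite: MochizukiFrdI2008, Ex. 4.6 p.87] -/
theorem hom_ext {A B : Obj P} {f f' : A ⟶ B} (h : val P f = val P f') : f = f' := Subtype.ext h

/-- Morphisms with prescribed coordinates. [cite: MochizukiFrdI2008, Ex. 4.6 p.87] -/
theorem exists_hom (A B : Obj P) (g : G) (a b : ℤ) (d : ℕ+) (ha : 0 ≤ a) (hb : 0 ≤ b)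
    (h : B.idx - (d : ℤ) * A.idx = a + b) : ∃ f : A ⟶ B, val P f = ⟨(g, a, b), d⟩ :=
  ⟨⟨⟨(g, a, b), d⟩, ha, hb, h⟩, rfl⟩

/-- Objects are determined by their index. [cite: MochizukiFrdI2008, Ex. 4.6 p.87] -/
theorem obj_ext {A B : Obj P} (h : A.idx = B.idx) : A = B := by
  cases A; cases B; cases h; rfl

/-- `d(f ≫ f') = d(f') · d(f)`. [cite: MochizukiFrdI2008, Ex. 4.6 p.87] -/
theorem comp_d {A B C' : Obj P} (f : A ⟶ B) (f' : B ⟶ C') : (val P (f ≫ f')).d = (val P f').d * (val P f).d := rfl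

/-- `a(f ≫ f') = a(f') + d(f') · a(f)`. [cite: MochizukiFrdI2008, Ex. 4.6 p.87] -/
theorem comp_a {A B C' : Obj P} (f : A ⟶ B) (f' : B ⟶ C') :
    (val P (f ≫ f')).a = (val P f').a + ((val P f').d : ℤ) * (val P f).a := rfl

/-- `b(f ≫ f') = b(f') + d(f') · b(f)`. [cite: MochizukiFrdI2008, Ex. 4.6 p.87] -/
theorem comp_b {A B C' : Obj P} (f : A ⟶ B) (f' : B ⟶ C') :
    (val P (f ≫ f')).b = (val P f').b + ((val P f').d : ℤ) * (val P f).b := rfl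

/-- `g(f ≫ f') = g(f') + d(f') · g(f) + a(f) · Ξ(d(f'))` (the twist by the `ξ_p`). [cite: MochizukiFrdI2008, Ex. 4.6 p.87] -/
theorem comp_g {A B C' : Obj P} (f : A ⟶ B) (f' : B ⟶ C') :
    (val P (f ≫ f')).μ.1 = (val P f').μ.1 + (((val P f').d : ℤ) • (val P f).μ.1 + (val P f).a • P.Ξ (val P f').d) := rfl

/-- The identity is `((0, 0, 0), 1)`. [cite: MochizukiFrdI2008, Ex. 4.6 p.87] -/
theorem val_id_eq (A : Obj P) : val P (𝟙 A) = ⟨(0, 0, 0), 1⟩ := rfl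

/-! ### The dictionary of Definition 1.2 for `C → F_Φ` -/

/-- `Base(f) = id` (one-morphism base). [cite: MochizukiFrdI2008, Ex. 4.6 p.87] -/
theorem base_eq {A B : Obj P} (f : A ⟶ B) : Base (toElem P) f = 𝟙 _ := rfl

/-- `deg_Fr(f) = d`. [cite: MochizukiFrdI2008, Ex. 4.6 p.87] -/
theorem degFr_eq {A B : Obj P} (f : A ⟶ B) : degFr (toElem P) f = (val P f).d := rfl

/-- `Div(f) = (a, b) ∈ ℤ_{≥0}²`. [cite: MochizukiFrdI2008, Ex. 4.6 p.87] -/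
theorem div_eq {A B : Obj P} (f : A ⟶ B) :
    Div (toElem P) f = Multiplicative.ofAdd (((val P f).a.toNat, (val P f).b.toNat) : ℕ × ℕ) := rfl

/-- Every morphism is a base-isomorphism. [cite: MochizukiFrdI2008, Ex. 4.6 p.87] -/
theorem isBaseIso {A B : Obj P} (f : A ⟶ B) : IsBaseIso (toElem P) f :=
  show IsIso (𝟙 _) from inferInstance

/-- Every endomorphism is base-identity. [cite: MochizukiFrdI2008, Ex. 4.6 p.87] -/
theorem isBaseIdentity {A : Obj P} (f : A ⟶ A) : IsBaseIdentity (toElem P) f := rfl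

/-- Linear `⟺ d = 1`. [cite: MochizukiFrdI2008, Ex. 4.6 p.87] -/
theorem isLinear_iff {A B : Obj P} (f : A ⟶ B) : IsLinear (toElem P) f ↔ (val P f).d = 1 := Iff.rfl

/-- Isometry `⟺ a = b = 0`. [cite: MochizukiFrdI2008, Ex. 4.6 p.87] -/
theorem isIsometry_iff {A B : Obj P} (f : A ⟶ B) : IsIsometry (toElem P) f ↔ (val P f).a = 0 ∧ (val P f).b = 0 := by
  have ha := a_nonneg P f
  have hb := b_nonneg P f
  change Multiplicative.ofAdd (((val P f).a.toNat, (val P f).b.toNat) : ℕ × ℕ) = 1 ↔ _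
  rw [← ofAdd_zero, Multiplicative.ofAdd.injective.eq_iff, Prod.mk_eq_zero, Int.toNat_eq_zero, Int.toNat_eq_zero]
  constructor
  · rintro ⟨h1, h2⟩; exact ⟨le_antisymm h1 ha, le_antisymm h2 hb⟩
  · rintro ⟨h1, h2⟩; exact ⟨h1.le, h2.le⟩

/-- Pre-step `⟺ d = 1`. [cite: MochizukiFrdI2008, Ex. 4.6 p.87] -/
theorem isPreStep_iff {A B : Obj P} (f : A ⟶ B) : IsPreStep (toElem P) f ↔ (val P f).d = 1 :=
  ⟨fun h => h.1, fun h => ⟨h, isBaseIso P f⟩⟩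

/-- In `N_{≥1}`, `a · c = b · c ⇒ a = b`. [cite: MochizukiFrdI2008, Ex. 4.6 p.87] -/
theorem pnat_mul_right_cancel {a b c : ℕ+} (h : a * c = b * c) : a = b := by
  have h' : (a : ℕ) * c = b * c := by exact_mod_cast congrArg PNat.val h
  exact PNat.coe_injective (Nat.eq_of_mul_eq_mul_right c.pos h')

/-- In `N_{≥1}`, `c · a = c · b ⇒ a = b`. [cite: MochizukiFrdI2008, Ex. 4.6 p.87] -/
theorem pnat_mul_left_cancel {a b c : ℕ+} (h : c * a = c * b) : a = b := by
  rw [mul_comm c a, mul_comm c b] at h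
  exact pnat_mul_right_cancel h

/-- If `x · y = 1` in `N` with nonnegative divisor coordinates, both factors have `d = 1`, `a = b = 0`.
[cite: MochizukiFrdI2008, Ex. 4.6 p.87] -/
theorem coords_of_mul_eq_one {x y : N P} (hxa : 0 ≤ x.a) (hxb : 0 ≤ x.b) (hya : 0 ≤ y.a) (hyb : 0 ≤ y.b)
    (h : x * y = 1) : (x.d = 1 ∧ x.a = 0 ∧ x.b = 0) ∧ (y.d = 1 ∧ y.a = 0 ∧ y.b = 0) := by
  have hd : x.d * y.d = 1 := by rw [← N.mul_d, h]; rfl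
  have hd' : (x.d : ℕ) * y.d = 1 := by exact_mod_cast congrArg PNat.val hd
  have hx1 : x.d = 1 := PNat.coe_eq_one_iff.mp (Nat.eq_one_of_mul_eq_one_right hd')
  have hy1 : y.d = 1 := PNat.coe_eq_one_iff.mp (Nat.eq_one_of_mul_eq_one_left hd')
  have ha : x.a + (x.d : ℤ) * y.a = 0 := by rw [← N.mul_a, h]; rfl
  have hb : x.b + (x.d : ℤ) * y.b = 0 := by rw [← N.mul_b, h]; rfl
  rw [hx1, PNat.one_coe, Nat.cast_one, one_mul] at ha hb
  refine ⟨⟨hx1, by linarith, by linarith⟩, hy1, by linarith, by linarith⟩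

/-- **Isomorphisms of `C` are the `(g, 0, 0, 1)`.** [cite: MochizukiFrdI2008, Ex. 4.6 p.87] -/
theorem isIso_iff {A B : Obj P} (f : A ⟶ B) : IsIso f ↔ (val P f).d = 1 ∧ (val P f).a = 0 ∧ (val P f).b = 0 := by
  constructor
  · intro hf
    have h : val P (inv f) * val P f = 1 := by rw [← val_comp, IsIso.hom_inv_id, val_id]
    exact (coords_of_mul_eq_one P (a_nonneg P _) (b_nonneg P _) (a_nonneg P f) (b_nonneg P f) h).2
  · rintro ⟨hd, ha, hb⟩
    have hidx : A.idx - (((1 : ℕ+) : ℕ) : ℤ) * B.idx = 0 + 0 := by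
      have := idx_eq P f
      rw [hd, ha, hb, PNat.one_coe, Nat.cast_one, one_mul] at this
      rw [PNat.one_coe, Nat.cast_one, one_mul]
      linarith
    obtain ⟨g, hg⟩ := exists_hom P B A (-(val P f).μ.1) 0 0 1 le_rfl le_rfl hidx
    have hμ : (val P f).μ = ((val P f).μ.1, 0, 0) := Prod.ext rfl (Prod.ext ha hb)
    refine ⟨g, hom_ext P ?_, hom_ext P ?_⟩
    · rw [val_comp, val_id, hg]
      refine N.ext ?_ ?_
      · rw [N.mul_μ, N.one_μ, hμ]
        show ((-(val P f).μ.1, (0 : ℤ), (0 : ℤ)) : Mmod G) + P.α 1 ((val P f).μ.1, 0, 0) = 0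
        rw [Datum.α_one, AddMonoidHom.id_apply]
        ext <;> simp
      · rw [N.mul_d, N.one_d, hd]; rfl
    · rw [val_comp, val_id, hg]
      refine N.ext ?_ ?_
      · rw [N.mul_μ, N.one_μ, hμ, hd]
        show (((val P f).μ.1, (0 : ℤ), (0 : ℤ)) : Mmod G) + P.α 1 (-(val P f).μ.1, 0, 0) = 0
        rw [Datum.α_one, AddMonoidHom.id_apply]
        ext <;> simp
      · rw [N.mul_d, hd]; rfl

/-- An isometric pre-step is an isomorphism: every object of `C` is isotropic. [cite: MochizukiFrdI2008, Ex. 4.6 p.87] -/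
theorem isIso_of_isIsometry_of_isPreStep {A B : Obj P} (f : A ⟶ B) (h₁ : IsIsometry (toElem P) f)
    (h₂ : IsPreStep (toElem P) f) : IsIso f :=
  (isIso_iff P f).mpr ⟨(isPreStep_iff P f).mp h₂, (isIsometry_iff P f).mp h₁⟩

/-- Every object of `C` is isotropic. [cite: MochizukiFrdI2008, Ex. 4.6 p.87] -/
theorem isIsotropic (A : Obj P) : IsIsotropic (toElem P) A :=
  fun _ f h₁ h₂ => isIso_of_isIsometry_of_isPreStep P f h₁ h₂

/-- **Every morphism of `C` is co-angular** (the middle isometric pre-step of any factorization is an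
isomorphism). [cite: MochizukiFrdI2008, Ex. 4.6 p.87] -/
theorem isCoAngular {A B : Obj P} (f : A ⟶ B) : IsCoAngular (toElem P) f :=
  fun _ _ _ β _ _ _ hβi hβp _ => isIso_of_isIsometry_of_isPreStep P β hβi hβp

/-- Co-angular pre-step `⟺ d = 1`. [cite: MochizukiFrdI2008, Ex. 4.6 p.87] -/
theorem isCoAngularPreStep_iff {A B : Obj P} (f : A ⟶ B) : IsCoAngularPreStep (toElem P) f ↔ (val P f).d = 1 :=
  ⟨fun h => (isPreStep_iff P f).mp h.2, fun h => ⟨isCoAngular P f, (isPreStep_iff P f).mpr h⟩⟩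

/-- Frobenius type `⟺ a = b = 0`. [cite: MochizukiFrdI2008, Ex. 4.6 p.87] -/
theorem isFrobeniusType_iff {A B : Obj P} (f : A ⟶ B) :
    IsFrobeniusType (toElem P) f ↔ (val P f).a = 0 ∧ (val P f).b = 0 :=
  ⟨fun h => (isIsometry_iff P f).mp h.1.2, fun h => ⟨⟨isCoAngular P f, (isIsometry_iff P f).mpr h⟩, isBaseIso P f⟩⟩

/-- **Pull-back morphisms of `C` are exactly the isomorphisms** (surjectivity of `γ ↦ φ ∘ γ` at `X = B` gives
a section of `φ`, which forces `d = 1`, `a = b = 0`). [cite: MochizukiFrdI2008, Ex. 4.6 p.87] -/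
theorem isPullbackMorphism_iff {A B : Obj P} (f : A ⟶ B) : IsPullbackMorphism (toElem P) f ↔ IsIso f := by
  refine ⟨fun h => ?_, fun h => isPullbackMorphism_of_isIso (toElem P) f⟩
  obtain ⟨γ, hγ⟩ := (h B).2 ⟨(𝟙 B, 𝟙 _), Subsingleton.elim _ _⟩
  have hγ1 : γ ≫ f = 𝟙 B := congrArg (fun p : PullbackHomData (toElem P) f B => p.1.1) hγ
  have hmul : val P f * val P γ = 1 := by rw [← val_comp, hγ1, val_id]
  exact (isIso_iff P f).mpr
    (coords_of_mul_eq_one P (a_nonneg P f) (b_nonneg P f) (a_nonneg P γ) (b_nonneg P γ) hmul).1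

/-! ### Epimorphisms, monomorphisms, connectedness -/

/-- **Every morphism of `C` is an epimorphism** (`d ≥ 1` and the group law of `M` cancel).
[cite: MochizukiFrdI2008, Ex. 4.6 p.87] -/
theorem epi {A B : Obj P} (f : A ⟶ B) : Epi f := by
  refine ⟨fun g g' h => hom_ext P ?_⟩
  have hv : val P g * val P f = val P g' * val P f := by rw [← val_comp, ← val_comp, h]
  have hd : (val P g).d = (val P g').d := pnat_mul_right_cancel (by rw [← N.mul_d, ← N.mul_d, hv])
  have hμ : (val P g).μ + P.α (val P g).d (val P f).μ = (val P g').μ + P.α (val P g').d (val P f).μ := by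
    rw [← N.mul_μ, ← N.mul_μ, hv]
  rw [hd] at hμ
  exact N.ext (add_right_cancel hμ) hd

/-- A linear morphism (`d = 1`) of `C` is a monomorphism. [cite: MochizukiFrdI2008, Ex. 4.6 p.87] -/
theorem mono_of_d_eq_one {A B : Obj P} (f : A ⟶ B) (hf : (val P f).d = 1) : Mono f := by
  refine ⟨fun g g' h => hom_ext P ?_⟩
  have hv : val P f * val P g = val P f * val P g' := by rw [← val_comp, ← val_comp, h]
  have hd : (val P g).d = (val P g').d := pnat_mul_left_cancel (by rw [← N.mul_d, ← N.mul_d, hv])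
  have hμ : (val P f).μ + P.α (val P f).d (val P g).μ = (val P f).μ + P.α (val P f).d (val P g').μ := by
    rw [← N.mul_μ, ← N.mul_μ, hv]
  rw [hf, Datum.α_one] at hμ
  exact N.ext (add_left_cancel hμ) hd

/-- `A_n → A_m` exists when `n ≤ m` (`(0, m − n, 0, 1)`). [cite: MochizukiFrdI2008, Ex. 4.6 p.87] -/
theorem nonempty_hom_of_le {A B : Obj P} (h : A.idx ≤ B.idx) : Nonempty (A ⟶ B) := by
  obtain ⟨f, -⟩ := exists_hom P A B 0 (B.idx - A.idx) 0 1 (by linarith) le_rfl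
    (by rw [PNat.one_coe, Nat.cast_one, one_mul, add_zero])
  exact ⟨f⟩

/-- `C` is connected (any two objects are comparable). [cite: MochizukiFrdI2008, Ex. 4.6 p.87] -/
theorem isGraphConnected_C : IsGraphConnected (Obj P) := by
  refine ⟨⟨A₀ P⟩, fun A B => ?_⟩
  rcases le_total A.idx B.idx with h | h
  · exact Zigzag.of_hom (nonempty_hom_of_le P h).some
  · exact Zigzag.of_inv (nonempty_hom_of_le P h).some

/-- `C` is totally epimorphic. [cite: MochizukiFrdI2008, Ex. 4.6 p.87] -/
theorem isTotallyEpimorphic_C : IsTotallyEpimorphic (Obj P) := ⟨fun f => epi P f⟩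

/-! ### The divisor monoid `Φ ≡ ℤ_{≥0} × ℤ_{≥0}` -/

/-- `ℤ_{≥0} × ℤ_{≥0}` is pre-divisorial. [cite: MochizukiFrdI2008, Ex. 4.6 p.87] -/
theorem isPreDivisorial_NN : IsPreDivisorial (Multiplicative (ℕ × ℕ)) :=
  IsPreDivisorial.of_mulEquiv (MulEquiv.prodMultiplicative (G := ℕ) (H := ℕ)).symm
    (StandardFrobenioidExample.isPreDivisorial_M.prod StandardFrobenioidExample.isPreDivisorial_M)

/-- `ℤ_{≥0} × ℤ_{≥0}` is sharp. [cite: MochizukiFrdI2008, Ex. 4.6 p.87] -/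
theorem isSharp_NN : IsSharp (Multiplicative (ℕ × ℕ)) := by
  refine ⟨fun x hx => ?_⟩
  obtain ⟨u, rfl⟩ := hx
  have h := congrArg Multiplicative.toAdd u.mul_inv
  rw [toAdd_mul, toAdd_one] at h
  have h1 : (Multiplicative.toAdd (u : Multiplicative (ℕ × ℕ))).1 = 0 := by
    have := congrArg Prod.fst h; simp only [Prod.fst_add, Prod.fst_zero] at this; omega
  have h2 : (Multiplicative.toAdd (u : Multiplicative (ℕ × ℕ))).2 = 0 := by
    have := congrArg Prod.snd h; simp only [Prod.snd_add, Prod.snd_zero] at this; omega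
  exact Multiplicative.toAdd.injective (Prod.ext h1 h2)

/-- `Φ ≡ ℤ_{≥0} × ℤ_{≥0}` is (objectwise) divisorial. [cite: MochizukiFrdI2008, Ex. 4.6 p.87] -/
theorem isDivisorial_Φ : Objectwise (fun N _ => IsDivisorial N) Literature.AlgebraicGeometry.Frobenioids.Ex46.Φ :=
  fun _ => ⟨isPreDivisorial_NN, isSharp_NN⟩

/-- `Φ` is a monoid on the one-morphism category (identity pull-backs). [cite: MochizukiFrdI2008, Ex. 4.6 p.87] -/
theorem isMonoidOn_Φ : IsMonoidOn Literature.AlgebraicGeometry.Frobenioids.Ex46.Φ :=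
  isMonoidOn_of_bijective fun _ => ⟨fun _ _ h => h, fun y => ⟨y, rfl⟩⟩

/-- **`C → F_Φ` is a pre-Frobenioid** (Def. 1.1 (iv)). [cite: MochizukiFrdI2008, Ex. 4.6 p.87] -/
theorem isPreFrobenioid : IsPreFrobenioid Literature.AlgebraicGeometry.Frobenioids.Ex46.Φ (toElem P) where
  isMonoidOn := isMonoidOn_Φ
  isDivisorial := isDivisorial_Φ
  isGraphConnected_base := StandardFrobenioidExample.isGraphConnected_D
  isTotallyEpimorphic_base := StandardFrobenioidExample.isTotallyEpimorphic_D
  isGraphConnected := isGraphConnected_C P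
  isTotallyEpimorphic := isTotallyEpimorphic_C P

end Ex46

end Literature.AlgebraicGeometry.Frobenioids
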